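import Mathlib
import Literature.Probability.Percolation.SmoothedWhiteNoise
import Literature.Probability.Percolation.DiscreteDomainPaths
import Literature.Probability.Percolation.ZdNearCriticalWindow
import Literature.Probability.Percolation.TriCollarLocalConn
import Literature.MathematicalPhysics.QuantumLattice.SchwartzTranslationCutoff

/-!
# Crossings of `R̄` by super-level sets of a continuous field, and discrete crossings (part 1)

Helper file for item `NoiseDiscretisation` (stmt-CriticalPhenomena-4598) of route
`CardyWhiteToColoured` (`CardyFormulaZ2`). For a conformal rectangle `R = (Ω; arcs 0–3)` and a
real function `F` on the plane we consider the continuum crossing event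
`PosCross[R, F, c]`: "some path in `closure Ω` from `arc 0` to `arc 2` has `F > c` along it" (the
event of the route's `continuumCrossingEvent`, read for the smoothed field `x ↦ ω (k ℓ x)` and
`c = 0`) and compare it with Smirnov's discrete crossing event `discreteCrossing Ω δ (arc 0) (arc 2)`
of G02 (largest mesh component `Ω_δ`, discrete arcs). To keep the helper files free of new
definitions, the three recurring objects are local notations (repeated verbatim in each file of
the series): `PosCross[R, F, c]`, the inner edges `InnerE[Ω, δ]` (lattice edges with both mesh
end-points in `Ω`; all edges of `Ω_δ` are inner) and the positive configuration `PosCfg[g]` of an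
edge function `g` (the route's `signConfig` is `PosCfg` of the smoothed lattice field).

This part proves the direction **discrete ⇒ continuum with a margin**: if `F` is continuous,
`a < b`, and `δ` is small (uniform continuity of `F` on `closure Ω` at precision `b − a`, and
`3δ < dist(arc 0, arc 2)`), then every bond configuration whose open inner edges carry
`F(midpoint) > b` and which realises `discreteCrossing` yields a path in `closure Ω` from `arc 0`
to `arc 2` with `F > a` (`posCrossing_of_discreteCrossing`, part 2): the open walk of `Ω_δ` is read as a
polyline of closed mesh edges (each within `δ/2` of its midpoint, inside `Ω̄` by the CHI/G02 edge
convention), completed at both ends by the segment from the arc vertex to its nearest point of the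
arc, which lies in `Ω̄` (`exists_mem_arc_segment_subset`, Smirnov's tie rule `≤`).

It also records the continuity of the smoothed field `x ↦ ω (k ℓ x)` of a configuration
(translations act continuously on `𝓢`, tree lemma `continuous_compSubConstCLM`).

References: S. Smirnov, C. R. Acad. Sci. Paris 333 (2001), §2 (discretisation, discrete arcs);
V. Beffara, D. Gayet, Publ. IHÉS 126 (2017), §1 (crossings by excursion sets of smooth fields).
-/

noncomputable section

namespace Summit.CriticalPhenomena.CardyFormulaZ2.Theorems

namespace WhiteToColoured

open Set Metric Filter Topology
open Literature.Probability.LatticeModels Literature.Probability.Percolation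
open Literature.Probability.RandomPlanarGeometry
open Literature.MathematicalPhysics.QuantumLattice

/-- `PosCross[R, F, c]`: some path in `closure R.carrier` from `arc 0` to `arc 2` has `F > c`. -/
local notation3 "PosCross[" R ", " F ", " c "]" =>
  ∃ x ∈ MarkedDomain.arc R (0 : Fin 4), ∃ y ∈ MarkedDomain.arc R (2 : Fin 4), ∃ γ : Path x y,
    ∀ t, γ t ∈ closure (JordanDomain.carrier (MarkedDomain.toJordanDomain R)) ∧
      (c : ℝ) < (F : ℂ → ℝ) (γ t)

/-- `InnerE[Ω, δ]`: the inner lattice edges at mesh `δ` (both mesh end-points in `Ω`). -/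
local notation3 "InnerE[" Ω ", " δ "]" =>
  {e : Sym2 (Site 2) | e ∈ (zdGraph 2).edgeSet ∧ ∀ v ∈ e, meshPoint δ v ∈ (Ω : Set ℂ)}

/-- `PosCfg[g]`: the bond configuration of positive values of the edge function `g`. -/
local notation3 "PosCfg[" g "]" =>
  {e : Sym2 (Site 2) | e ∈ (zdGraph 2).edgeSet ∧ (0 : ℝ) < (g : Sym2 (Site 2) → ℝ) e}

/-! ### The smoothed field of a configuration -/

/-- A Gaussian bump centred at `x` is the translate by `x` of the bump centred at `0`. -/
theorem bump_eq_compSubConstCLM {k : ℝ → ℂ → SchwartzMap ℂ ℝ} (hk : IsGaussianBumpFamily k) {ℓ : ℝ}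
    (hℓ : 0 < ℓ) (x : ℂ) : k ℓ x = SchwartzMap.compSubConstCLM ℝ x (k ℓ 0) := by
  ext y
  rw [SchwartzMap.compSubConstCLM_apply, hk ℓ hℓ, hk ℓ hℓ]
  simp

/-- The smoothed field of every configuration is continuous (translations act continuously on
`𝓢`, `continuous_compSubConstCLM`; `ω` is continuous). -/
theorem continuous_field {k : ℝ → ℂ → SchwartzMap ℂ ℝ} (hk : IsGaussianBumpFamily k) {ℓ : ℝ}
    (hℓ : 0 < ℓ) (ω : FieldConfig ℂ) : Continuous fun x => ω (k ℓ x) := by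
  have h : (fun x : ℂ => k ℓ x) = fun x => SchwartzMap.compSubConstCLM ℝ x (k ℓ 0) :=
    funext fun x => bump_eq_compSubConstCLM hk hℓ x
  have hc : Continuous (fun x : ℂ => k ℓ x) := by
    rw [h]; exact continuous_compSubConstCLM (𝕜 := ℝ) (k ℓ 0)
  exact ω.continuous.comp hc

/-! ### Continuum crossings with a margin -/

/-- `PosCross[R, F, c]` as a `JoinedIn` statement for the super-level set `{F > c} ∩ Ω̄`. -/
theorem posCross_iff_joinedIn {R : ConformalRectangle} {c : ℝ} {F : ℂ → ℝ} :
    PosCross[R, F, c] ↔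
      ∃ x ∈ R.arc 0, ∃ y ∈ R.arc 2, JoinedIn {z | z ∈ closure R.carrier ∧ c < F z} x y :=
  Iff.rfl

/-- The route's continuum crossing event is the level-`0` crossing event of the smoothed field. -/
theorem continuumCrossingEvent_eq_posCross (k : ℝ → ℂ → SchwartzMap ℂ ℝ) (ℓ : ℝ)
    (R : ConformalRectangle) :
    continuumCrossingEvent k ℓ R = {ω | PosCross[R, fun x => ω (k ℓ x), 0]} := rfl

/-- Crossing at a higher level implies crossing at a lower level. -/
theorem posCross_mono {R : ConformalRectangle} {F : ℂ → ℝ} {c c' : ℝ} (h : c ≤ c')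
    (hF : PosCross[R, F, c']) : PosCross[R, F, c] := by
  obtain ⟨x, hx, y, hy, γ, hγ⟩ := hF
  exact ⟨x, hx, y, hy, γ, fun t => ⟨(hγ t).1, h.trans_lt (hγ t).2⟩⟩

/-- **Margin.** A crossing at level `c` by a path along which `F` is continuous is a crossing at
some level `c' > c` (the path is compact). -/
theorem exists_lt_posCross {R : ConformalRectangle} {c : ℝ} {F : ℂ → ℝ}
    (hF : Continuous F) (h : PosCross[R, F, c]) : ∃ c', c < c' ∧ PosCross[R, F, c'] := by
  obtain ⟨x, hx, y, hy, γ, hγ⟩ := h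
  have hcont : Continuous fun t : unitInterval => F (γ t) := hF.comp γ.continuous
  obtain ⟨t₀, -, ht₀⟩ := isCompact_univ.exists_isMinOn univ_nonempty hcont.continuousOn
  refine ⟨(c + F (γ t₀)) / 2, by linarith [(hγ t₀).2], x, hx, y, hy, γ, fun t => ⟨(hγ t).1, ?_⟩⟩
  have h1 : F (γ t₀) ≤ F (γ t) := ht₀ (mem_univ t)
  linarith [(hγ t₀).2]

/-! ### Inner edges and positive configurations -/

/-- The route's sign configuration is the positive configuration of the smoothed lattice field
read at the medial points. -/
theorem signConfig_eq_posCfg (ℓ δ : ℝ) (ξ : (zdGraph 2).edgeSet → ℝ) :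
    signConfig ℓ δ ξ = PosCfg[fun e => smoothedNoise ℓ δ ξ (medialPoint δ e)] := rfl

/-- Scaling an edge function by a positive constant does not change its positive configuration. -/
theorem posCfg_const_mul {c : ℝ} (hc : 0 < c) (g : Sym2 (Site 2) → ℝ) :
    PosCfg[fun e => c * g e] = PosCfg[g] := by
  ext e
  simp only [mem_setOf_eq]
  exact and_congr_right fun _ => mul_pos_iff_of_pos_left hc

/-- An edge of `openGraph ω ⊓ Ω_δ` is an open inner edge whose closed mesh segment lies in
`Ω̄`. -/
theorem inner_of_adj {Ω : Set ℂ} {δ : ℝ} {ω : BondConfig (Site 2)} {p q : Site 2}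
    (h : (openGraph ω ⊓ discreteDomainGraph Ω δ).Adj p q) :
    s(p, q) ∈ ω ∧ s(p, q) ∈ InnerE[Ω, δ] ∧
      segment ℝ (meshPoint δ p) (meshPoint δ q) ⊆ closure Ω ∧ (zdGraph 2).Adj p q := by
  obtain ⟨hω, hmesh, hp, hq⟩ := open_inf_discreteDomainGraph_adj_iff.1 h
  obtain ⟨hzd, hseg⟩ := meshGraph_adj_iff.1 hmesh
  refine ⟨hω, ⟨(SimpleGraph.mem_edgeSet _).2 hzd, fun v hv => ?_⟩, hseg, hzd⟩
  rcases Sym2.mem_iff.1 hv with rfl | rfl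
  · exact meshDomain_subset_meshVertices Ω δ hp
  · exact meshDomain_subset_meshVertices Ω δ hq

/-- The discrete crossing event only depends on the states of the inner edges. -/
theorem mem_discreteCrossing_iff_of_inter_innerE_eq {Ω : Set ℂ} {δ : ℝ} {A B : Set ℂ}
    {ω ω' : BondConfig (Site 2)} (h : ω ∩ InnerE[Ω, δ] = ω' ∩ InnerE[Ω, δ]) :
    ω ∈ discreteCrossing Ω δ A B ↔ ω' ∈ discreteCrossing Ω δ A B := by
  have key : ω ∩ (discreteDomainGraph Ω δ).edgeSet = ω' ∩ (discreteDomainGraph Ω δ).edgeSet := by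
    ext e
    induction e using Sym2.ind with
    | h p q =>
      simp only [mem_inter_iff, SimpleGraph.mem_edgeSet]
      constructor
      · rintro ⟨he, hadj⟩
        have hin : s(p, q) ∈ InnerE[Ω, δ] :=
          (inner_of_adj (ω := Set.univ) ((SimpleGraph.inf_adj _ _ _ _).2 ⟨⟨mem_univ _, hadj.ne⟩, hadj⟩)).2.1
        have : s(p, q) ∈ ω' ∩ InnerE[Ω, δ] := h ▸ ⟨he, hin⟩
        exact ⟨this.1, hadj⟩
      · rintro ⟨he, hadj⟩
        have hin : s(p, q) ∈ InnerE[Ω, δ] :=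
          (inner_of_adj (ω := Set.univ) ((SimpleGraph.inf_adj _ _ _ _).2 ⟨⟨mem_univ _, hadj.ne⟩, hadj⟩)).2.1
        have : s(p, q) ∈ ω ∩ InnerE[Ω, δ] := h.symm ▸ ⟨he, hin⟩
        exact ⟨this.1, hadj⟩
  rw [discreteCrossing_eq_iUnion]
  simp only [mem_iUnion, mem_preimage, key]

/-! ### Geometry of mesh segments -/

/-- A point of a segment is within half the length of the segment of its midpoint. -/
theorem dist_midpoint_le_of_mem_segment {u v z : ℂ} (hz : z ∈ segment ℝ u v) :
    dist z ((u + v) / 2) ≤ dist u v / 2 := by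
  rw [segment_eq_image_lineMap] at hz
  obtain ⟨t, ⟨ht0, ht1⟩, rfl⟩ := hz
  rw [AffineMap.lineMap_apply_module, dist_eq_norm, dist_eq_norm]
  have : (1 - t) • u + t • v - (u + v) / 2 = ((t : ℂ) - 1 / 2) * (v - u) := by
    simp only [Complex.real_smul]; push_cast; ring
  rw [this, norm_mul, show ((t : ℂ) - 1 / 2) = ((t - 1 / 2 : ℝ) : ℂ) by push_cast; ring,
    Complex.norm_real, Real.norm_eq_abs, norm_sub_rev]
  have h : |t - 1 / 2| ≤ 1 / 2 := abs_le.2 ⟨by linarith, by linarith⟩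
  calc |t - 1 / 2| * ‖u - v‖ ≤ 1 / 2 * ‖u - v‖ := by gcongr
    _ = ‖u - v‖ / 2 := by ring

/-- On a segment, only the far end-point is at the full distance from the near end-point. -/
theorem eq_of_mem_segment_of_dist_eq {u v z : ℂ} (hz : z ∈ segment ℝ u v) (h : dist u z = dist u v) :
    z = v := by
  rw [segment_eq_image_lineMap] at hz
  obtain ⟨t, ⟨ht0, ht1⟩, rfl⟩ := hz
  rw [AffineMap.lineMap_apply_module] at h ⊢
  by_cases huv : u = v
  · subst huv
    rw [← add_smul, sub_add_cancel, one_smul]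
  · have hd : dist u ((1 - t) • u + t • v) = t * dist u v := by
      rw [dist_eq_norm, dist_eq_norm,
        show u - ((1 - t) • u + t • v) = ((t : ℂ)) * (u - v) by
          simp only [Complex.real_smul]; push_cast; ring,
        norm_mul, Complex.norm_real, Real.norm_eq_abs, abs_of_nonneg ht0]
    rw [hd] at h
    have hpos : 0 < dist u v := dist_pos.2 huv
    have ht : t = 1 := by
      have := mul_right_cancel₀ hpos.ne' (h.trans (one_mul _).symm)
      exact this
    subst ht
    simp

/-- Points of a closed mesh edge of `δℤ²` are within `δ/2` of its medial point. -/
theorem dist_medialPoint_le_of_mem_segment {δ : ℝ} (hδ : 0 < δ) {p q : Site 2}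
    (hpq : (zdGraph 2).Adj p q) {z : ℂ} (hz : z ∈ segment ℝ (meshPoint δ p) (meshPoint δ q)) :
    dist z (medialPoint δ s(p, q)) ≤ δ / 2 := by
  rw [medialPoint_mk]
  refine (dist_midpoint_le_of_mem_segment hz).trans ?_
  rw [dist_meshPoint_of_adj hpq, abs_of_pos hδ]

/-- **Nearest point of the arc.** A vertex of the discrete arc of `arc i` is within `δ` of a point
`a` of `arc i` such that the closed segment from its mesh point to `a` lies in `Ω̄` (the nearest
point of the arc is a nearest point of the whole boundary, by the tie rule `≤`). -/
theorem exists_mem_arc_segment_subset (R : ConformalRectangle) (i : Fin 4) {δ : ℝ} (hδ : 0 < δ)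
    {x : Site 2} (hx : x ∈ discreteArc R.carrier δ (R.arc i)) :
    ∃ a ∈ R.arc i, dist (meshPoint δ x) a ≤ δ ∧
      segment ℝ (meshPoint δ x) a ⊆ closure R.carrier := by
  have hΩ : IsOpen R.carrier := R.isOpen
  obtain ⟨a, ha, hda⟩ := (R.isCompact_arc i).exists_infDist_eq_dist ⟨_, R.pt_mem_arc_self i⟩
    (meshPoint δ x)
  have h1 : infDist (meshPoint δ x) (R.arc i) ≤ infDist (meshPoint δ x) (frontier R.carrier) :=
    infDist_le_infDist_frontier_of_mem_discreteArc hΩ hx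
  have h2 : infDist (meshPoint δ x) (frontier R.carrier) ≤ |δ| :=
    infDist_frontier_le_of_mem_meshBoundary hΩ hx.1
  have hxΩ : meshPoint δ x ∈ R.carrier := meshDomain_subset_meshVertices _ _ hx.1.1
  refine ⟨a, ha, by rw [← hda]; exact h1.trans (h2.trans (abs_of_pos hδ).le), ?_⟩
  intro z hz
  by_contra hzc
  have hzΩ : z ∉ R.carrier := fun h => hzc (subset_closure h)
  have hsub : segment ℝ (meshPoint δ x) z ⊆ segment ℝ (meshPoint δ x) a :=
    (convex_segment _ _).segment_subset (left_mem_segment ℝ _ _) hz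
  obtain ⟨f, hf, hff⟩ := exists_mem_segment_frontier hΩ hxΩ
    (fun hs => hzΩ (hs (right_mem_segment ℝ _ _)))
  -- `f` is a frontier point on `[δx, z]`, hence at distance `≥ infDist _ (arc i) = dist _ a`
  have hfd : dist (meshPoint δ x) a ≤ dist (meshPoint δ x) f := by
    rw [← hda]; exact h1.trans (infDist_le_dist_of_mem hff)
  have hfz : dist (meshPoint δ x) f ≤ dist (meshPoint δ x) z := dist_le_of_mem_segment_left hf
  have hza : dist (meshPoint δ x) z ≤ dist (meshPoint δ x) a := dist_le_of_mem_segment_left hz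
  have heq : dist (meshPoint δ x) z = dist (meshPoint δ x) a := le_antisymm hza (hfd.trans hfz)
  have hza' : z = a := eq_of_mem_segment_of_dist_eq hz heq
  refine hzc ?_
  rw [hza']
  exact frontier_subset_closure (R.arc_subset_frontier i ha)

end WhiteToColoured

end Summit.CriticalPhenomena.CardyFormulaZ2.Theorems
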